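import Summits.BirchSwinnertonDyer.Rank1Residual.O6.X4CongruenceAnchor
import HarnessLib

/-!
# O6 / X4 ∧ ¬(12.5.2), rank 0, the `t = 1` sub-corner: (A⋆⋆) FIRST-LAYER ANCHORS and T-X4E-t1 (typed targets)
(cell `b2b-bsdres`, lane CLASS-CLOSURE, class O6 §3.4 ∩ X4, sub-corner R-X4E-t1 = {`388800ha1`, `388800ij1`}; planner o6-r1 GEN 22 —
 memo `HOME/b2b-bsdres-o6-r1/gen22/O6-GEN22.md` (sha16 `f5929fb650004bca`) §6, typed sketch `gen22/lean/O6X3KatoMember.lean`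
 (sha16 `3b84133d0e97abae`) §X4E-t1; typer of record cc-typer-5 GEN 15; sibling of `O6/X4CongruenceAnchor.lean` ((T-μ), (A⋆), T-X4E),
 split off for `lint.size`; decl bodies byte-identical to the sketch, the one consumer call re-pointed to the tree's
 `exists_shaAn_le_add_torsion_of_katoCurrency`; 0 Literature facts.)

HONEST FRAMING (cell `b2b-bsdres`, run/shared/lean/b2b/bsd-rank1-residual/, verbatim in every file): the goal of the cell is
to DELETE the COMBINATION-SHAPED residual classes of the Birch–Swinnerton-Dyer formula for ALL analytic-rank `≤ 1` elliptic
curves over `ℚ` — "full BSD formula for every rank `≤ 1` curve in class `C`" assembled STRICTLY from published theorems — so that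
the rank-`≤ 1` remainder becomes exactly the CONSTRUCTION-SHAPED classes, which are TYPED (missing-input `Prop`s), NOT attempted.
This is not "finishing BSD". Lane CLASS-CLOSURE: research routes; census output is EVIDENCE / conjecture items, never a Literature
fact; no main conjecture inside any certificate; nothing is booked; no mark of `RESIDUAL-MAP.md` moves; O6 and X4 stay OPEN.

WHAT THE PLANNER FOUND (sketch §X4E-t1 section text, verbatim): — the `t = 1` sub-corner: FIRST-LAYER anchors (o6-r1 GEN 22; question Q-t1, statement (A⋆⋆))

For a target `W` with `W(ℚ_p)[p] ≠ 0` (the O6 ∧ r0 Elkies pairs `388800ha1`, `388800ij1`: Kodaira IV* at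
`3`, `c₃ = 3`, `#W(ℚ₃)[3^∞] = 3`) EVERY congruent curve `W′` has `W′(ℚ_p)[p] = (W[p])^{G_{ℚ_p}} ≠ 0`, so
the hypothesis `W′(ℚ_p)[p] = 0` of (A⋆) is unsatisfiable on the whole `W[p]`-class (census C-X4E-0:
the three certified congruent unit candidates `25920s1, 25920bf1, 25920bf2` of `388800ij1` all have
`#W′(ℚ₃)[3^∞] = 3`).  (A⋆⋆) replaces it by an ARITHMETIC CERTIFICATE OVER THE FIRST LAYER `K = ℚ₁` of
the cyclotomic `ℤ_p`-extension (`p = 3`: `K = ℚ(ζ₉)⁺ = ℚ[x]/(x³ − 3x + 1)`, discriminant `81`).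

DERIVATION (THEOREM-CANDIDATE; memo `gen22/O6-GEN22.md` §6; audits AUD-14 (twisted Artin–Verdier) and
AUD-19 (the O[[Γ]]-descent at a finite-order character); notation of (A⋆): `T′ = T_pW′`, `Λ₀ = ℤ_p[[Γ]]`,
`X′ = 𝐇²(T′)⁰`, `𝐇¹(T′)⁰ = Λ₀·c`, `z = u·c`).
(1) For EVERY unit anchor (hypotheses of (A⋆) except `W′(ℚ_p)[p] = 0`), step (f) of (A⋆) gives
`(char X′) = (u)` EXACTLY and `v_p(u(0)) = t′ − x ≤ t′`, `t′ := ord_p #W′(ℚ_p)[p^∞]`.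
(2) Let `ψ` be a character of `Γ` of order `p`, `O = ℤ_p[ζ_p]`, `π = ζ_p − 1`, `ζ = ψ(γ)`.  If `μ(u) ≥ 1`
then `v_π(u(ζ − 1)) ≥ v_π(p) = p − 1`; in general `v_π(u(ζ − 1)) ≥ μ(u)(p − 1) + min(λ(u), p − 1)`.
(3) `O[[Γ]]`-descent at `ψ` (`0 → Λ_O →(γ − ζ) Λ_O → O(ψ) → 0`, `H⁰ = H³ = 0`, Shapiro):
`X′_O/(γ − ζ) ≅ H²(ℤ[1/p], T′ ⊗ O(ψ))` and `v_π(char_{X′}(ζ − 1)) = length_O X′_O/(γ − ζ) − length_O X′_O[γ − ζ]`.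
(4) Poitou–Tate / Artin–Verdier: `length_O H²(ℤ[1/p], T′ ⊗ O(ψ)) = length_O Ш²_ψ + length_O (W′[p^∞] ⊗ O(ψ⁻¹))^{G_{ℚ_p}}`,
and the LOCAL TERM IS `min(t′, 1)` for `t′ ≤ 1`: its `π`-torsion is `(W′[p])^{G_{ℚ_p}}`; when this is a
line `⟨v⟩` the quotient character is `det = ω ≠ 1` on `G_{ℚ_p}`, and a `G_{ℚ_p}`-fixed lift of `v` to
level `π²` would solve `(ρ̄(σ) − 1) b = −c(σ) v` with `c = (ψ⁻¹ − 1)/π mod π ≠ 0` (ψ is ramified at p),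
impossible.  Hence `v_π(u(ζ − 1)) ≤ 1 + length_O Ш²_ψ`.
(5) `Ш²_ψ^∨ = Ш¹(ℤ[1/p], W′[p^∞] ⊗ O(ψ⁻¹))` (classes unramified outside `p` — there locally trivial, as
`W′(ℚ_ℓ)[p] = 0` at additive `ℓ` by `p ∤ c_ℓ` — and trivial at `p`) restricts injectively to
`K = ℚ̄^{ker ψ}` (`W′[p]^{G_K} = 0`: an image `⊇ SL₂(𝔽_p)` has no normal subgroup of index `p`) into the
everywhere-locally-trivial classes of `H¹(K, W′[p^∞]) ⊗ O`, i.e. into `Ш(W′/K)[p^∞] ⊗ O` once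
`rank W′(K) = 0` (and `W′(K)[p] = 0`).
(6) So `rank W′(K) = 0 ∧ Ш(W′/K)[p] = 0 ⇒ Ш²_ψ = 0 ⇒ v_π(u(ζ − 1)) ≤ 1 < p − 1 ⇒ μ(X′) = μ(u) = 0`
(indeed `λ(X′) ≤ 1`).  No twisted `L`-value and no normalisation of 12.5 (1) enter; `L(W′/K, 1) ≠ 0`
gives `rank W′(K) = 0` (Kato, Cor. 14.3, abelian `K`), and `Ш(W′/K)[p] = 0` is a per-curve certificate
(`p`-descent over `K`) whose BSD proxy `p ∤ #Ш_an(W′/K)` is census test C-X4E-1 (ii) (kit j158875).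
[cite: Kato2004Asterisque, Thm. 12.4 (3) (p. 221), Thm. 12.5 (4), (12.5.1), (12.5.2) (p. 222), Cor. 14.3 (p. 235)]
[cite: MilneADT2006, Thm. II.3.1 and Cor. II.3.3] 

WHAT IS TYPED (bodies verbatim): `IsFirstCyclotomicLayer K p` (bookkeeping over Mathlib's `IsGalois`, `Module.finrank`, `NumberField.discr`);
**(A⋆⋆)** `@[conjecture] FineMuZeroOfFirstLayerAnchor FineMuZero` (THEOREM-CANDIDATE by the planner's derivation (1)–(6); lit-kato GEN 36:
AUD-14 / AUD-19 PASS — the descent is Kato (14.14.1)–(14.14.2) p. 243 + 13.8 p. 228 twisted, the length lemma is Kato Lemma 14.15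
pp. 243–244, Cor. 14.3 p. 235 hypotheses exact (and Cor. 14.3 (2) is typed in the tree: `kato_finite_chiPart_of_twistedLValue_ne_zero` /
`finite_point_of_isTotallyReal_of_kato` — bind by name if the rank-0 conjunct is ever discharged from L-values); NOT in print as stated;
`@[conjecture]` until a tree proof); `IsKatoFirstLayerAnchor`; **T-X4E-t1** `@[conjecture] X4UpperOfCongruentFirstLayerAnchor`
= (Kμ-K) ∘ (T-μ) ∘ (A⋆⋆), interface eliminated, PROVED composition `x4UpperOfCongruentFirstLayerAnchor_of`; PROVED
`isKatoFirstLayerAnchor_of_unit` (a unit anchor + the first-layer certificate is a first-layer anchor), readings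
`X4WildRankZero.missingUpperBoundAt_of_congruentFirstLayerAnchor`, `…missingPPartAt_of_congruentFirstLayerAnchor_of_unit`.
DEDUP (`lean search`): `IsFirstCyclotomicLayer`, `FineMuZeroOfFirstLayerAnchor`, `IsKatoFirstLayerAnchor`, `X4UpperOfCongruentFirstLayerAnchor`
— no match; reused by name: `ModPCongruent`, `IsKatoUnitAnchor`, `X4UpperOfFineMuZero`, `FineMuZeroCongruenceInvariant`, `torsionPoints`,
`galH1`, `sha`, `baseChange`, `mordellWeilRank`, `exists_shaAn_le_add_torsion_of_katoCurrency`.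

EVIDENCE of record (o6-r1 GEN 22, memo §6.3 / ADDENDUM; instrumentation only): census test C-X4E-1 (ii) = probe P-X4E-K over
`K = ℚ(ζ₉)⁺ = ℚ[x]/(x³ − 3x + 1)` (kit j158875 local data, j158951 L-values): ALL THREE certified congruent `t′ = 1` unit candidates
`25920s1 / 25920bf1 / 25920bf2` of `388800ij1` FAIL the first-layer certificate (`#Ш_an(E′/K) = 9, 9, 441` with `L(E′/K,1) ≠ 0` ⇒
`Sel₃∞(E′/K) ≠ 0`) ⇒ R-X4E-t1 = {`388800ha1`, `388800ij1`} UNCHANGED (18/20 stands); the notion is non-vacuous (scan j159271 / j159272,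
interim 168/436 rows: 14/15 small-conductor `t′ = 1` unit curves with `L(E/K,1) ≠ 0` pass; `270c1` ✓ vs `459c1` ✗ share the coarse type II,
`v₃(N) = 3`); by genus theory (memo §6.3′ (G2)) the certificate is EQUIVALENT to `3 ∤ [E′(ℚ₃) : N E′(K_𝔭)]`.  PRESEARCH (typer): (A⋆⋆) →
none in print (corpus + galaxy; nearest = Kato Cor. 14.3, Coates–Sujatha / Lim–Sujatha fine-Selmer control).
References: K. Kato, Astérisque 295 (2004) Thm. 12.4 (3), Thm. 12.5 (4), (12.5.1)–(12.5.2), Cor. 14.3 [Kato2004Asterisque]; J. S. Milne,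
ADT Thm. II.3.1 / Cor. II.3.3 [MilneADT2006]; M. F. Lim, R. Sujatha, J. Number Theory 187 (2018) §3 [LimSujatha2018]; R. L. Miller, LMS J.
Comput. Math. 14 (2011) §1, Def. 1.1 [Miller2011LMS]; H. Darmon, CBMS 101 (2004) Thm. 3.22 [Darmon2004].
-/

set_option autoImplicit false

noncomputable section

open scoped Classical

open WeierstrassCurve Literature.NumberTheory.EllipticCurves
  Literature.NumberTheory.EllipticCurves.Rank1Residual
  Literature.NumberTheory.EllipticCurves.Rank1Residual.Typed
  Summit.BirchSwinnertonDyer.Rank1Residual.Additive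

namespace Summit.BirchSwinnertonDyer.Rank1Residual.O6

/-! ## §X4E-t1 — the typed statements (o6-r1 GEN 22 sketch §X4E-t1; bodies verbatim) -/

section X4Et1

variable (FineMuZero : ∀ (W : WeierstrassCurve ℚ) [W.IsElliptic], ℕ → Prop)

/-- `K` is (a model of) the FIRST LAYER `ℚ₁` of the cyclotomic `ℤ_p`-extension of `ℚ`: Galois over `ℚ`
of degree `p` with `|disc K|` a power of `p` (for odd `p` the unique such field is the degree-`p` subfield
of `ℚ(ζ_{p²})`, of conductor `p²`; `p = 3`: `ℚ(ζ₉)⁺ = ℚ[x]/(x³ − 3x + 1)`, `disc = 81`).  Bookkeeping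
definition over Mathlib's `IsGalois`, `Module.finrank`, `NumberField.discr`. [folklore] -/
def IsFirstCyclotomicLayer (K : Type) [Field K] [NumberField K] (p : ℕ) : Prop :=
  IsGalois ℚ K ∧ Module.finrank ℚ K = p ∧ ∃ k : ℕ, (NumberField.discr K).natAbs = p ^ k

/-- EVIDENCE: **theorem-candidate (derivation above, steps (1)–(6); audits AUD-14, AUD-19 PASS — lit-kato GEN 36, KATO-PAGE-READ-gen36.md 2175bd9283491ed4; originally asked of
lit-kato; NOT in print as stated; not reviewed)** — **(A⋆⋆) the FIRST-LAYER ANCHOR LEMMA (o6-r1 GEN 22).**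
For a globally minimal `W′/ℚ` and an odd prime `p` with: ADDITIVE, POTENTIALLY GOOD reduction at `p`;
(12.5.2); `#W′(ℚ_p)[p^∞] ≤ p` (read: `#W′(ℚ_p)[p²] ≤ p`); `L(W′,1)/Ω(W′)` a nonzero `p`-adic unit; and a
first layer `K` with `rank W′(K) = 0` and `Ш(W′/K)[p] = 0` — the interface `FineMuZero W′ p` holds
(`μ(𝐇²(T_pW′)⁰) = 0`, indeed `λ ≤ 1`).  For `W′(ℚ_p)[p] = 0` this is (A⋆) plus a redundant hypothesis.
Its only use is through (T-μ): it makes `W′` an ANCHOR for targets with `W(ℚ_p)[p] ≠ 0`.  By genus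
theory (memo §6.3′ (G1)–(G2): inflation–restriction, Poitou–Tate, Mazur's lemma at unramified primes,
Herbrand quotient 1 at `𝔭`, `p`-group fixed points) the last hypothesis is EQUIVALENT, for a unit anchor, to
`Sel_{p^∞}(W′/K) = 0` and to the LOCAL condition `p ∤ [W′(ℚ_p) : N_{K_𝔭/ℚ_p} W′(K_𝔭)]`; census: it FAILS
for the three `t′ = 1` candidates of `388800ij1` (`#Ш_an(W′/K) = 9, 9, 441`, kit j158951) and holds for
many `t′ = 1` unit curves (scan kit j159271/j159272).  Nothing asserted.
[cite: Kato2004Asterisque, Thm. 12.4 (3) (p. 221), Thm. 12.5 (4) and (12.5.2) (p. 222), Cor. 14.3 (p. 235)]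
[cite: MilneADT2006, Thm. II.3.1 (Artin–Verdier) and Cor. II.3.3] -/
@[conjecture] def FineMuZeroOfFirstLayerAnchor : Prop :=
  ∀ (W' : WeierstrassCurve ℚ) [W'.IsElliptic] [W'.IsGloballyMinimal] (p : ℕ) [Fact p.Prime],
    p ≠ 2 →
    ¬ W'.HasGoodReductionAtPrime p → ¬ W'.HasMultiplicativeReductionAtPrime p →
    0 ≤ padicValRat p W'.j →
    Kato2004.ImageContainsSL2 W' p →
    Nat.card (torsionPoints W' ℚ_[p] ((p : ℤ) ^ 2)) ≤ p →
    (∃ q' : ℚ, W'.entireLFunction 1 / (W'.realPeriodRat : ℂ) = (q' : ℂ) ∧ q' ≠ 0 ∧ padicValRat p q' = 0) →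
    (∃ (K : Type) (_ : Field K) (_ : NumberField K), IsFirstCyclotomicLayer K p ∧
        (W'.baseChange K).mordellWeilRank = 0 ∧
        (W'.baseChange K).sha ⊓ AddSubgroup.torsionBy (W'.baseChange K).galH1 p = ⊥) →
    FineMuZero W' p

/-- The FIRST-LAYER ANCHOR predicate for `(W′, p)`: the hypotheses of (A⋆⋆), bundled.  Bookkeeping. [folklore] -/
def IsKatoFirstLayerAnchor (W' : WeierstrassCurve ℚ) [W'.IsElliptic] (p : ℕ) [Fact p.Prime] : Prop :=
  ¬ W'.HasGoodReductionAtPrime p ∧ ¬ W'.HasMultiplicativeReductionAtPrime p ∧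
    0 ≤ padicValRat p W'.j ∧ Kato2004.ImageContainsSL2 W' p ∧
    Nat.card (torsionPoints W' ℚ_[p] ((p : ℤ) ^ 2)) ≤ p ∧
    (∃ q' : ℚ, W'.entireLFunction 1 / (W'.realPeriodRat : ℂ) = (q' : ℂ) ∧ q' ≠ 0 ∧ padicValRat p q' = 0) ∧
    ∃ (K : Type) (_ : Field K) (_ : NumberField K), IsFirstCyclotomicLayer K p ∧
        (W'.baseChange K).mordellWeilRank = 0 ∧
        (W'.baseChange K).sha ⊓ AddSubgroup.torsionBy (W'.baseChange K).galH1 p = ⊥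

/-- **T-X4E-t1 — the Elkies `t = 1` sub-corner target (o6-r1 GEN 22): Kato's A161″ conclusion on an
additive potentially good pair `(W, p)` with `W[p]` irreducible, GIVEN a congruent FIRST-LAYER anchor**
= (Kμ-K) ∘ (T-μ) ∘ (A⋆⋆), interface eliminated (proved composition below).  Census test C-X4E-1 (ii)
(kit j158875/j158951: BSD data of the candidates over `ℚ(ζ₉)⁺` — all three candidates of `388800ij1` fail it).  EVIDENCE-labelled conjecture declaration;
nothing asserted. [cite: Kato2004Asterisque, Thm. 12.4 (3), 12.5 (4), 12.6 (pp. 221–222), Cor. 14.3 (p. 235), cf. Lemma 14.7 (p. 238)]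
[evidence: o6-r1 GEN 22 census test C-X4E-1 (ii) = probe P-X4E-K over K = ℚ(ζ₉)⁺ (kit j158875 local data, j158951 L-values; memo gen22/O6-GEN22.md f5929fb650004bca §6.3 + ADDENDUM): all three certified congruent t′ = 1 unit candidates 25920s1 / 25920bf1 / 25920bf2 of 388800ij1 FAIL the first-layer certificate (#Ш_an(E′/K) = 9, 9, 441) ⇒ R-X4E-t1 = {388800ha1, 388800ij1} unchanged; scan j159271 / j159272 interim 168/436 rows: 14/15 small-conductor t′ = 1 unit curves pass (270c1 ✓, 459c1 ✗); lit-kato GEN 36 AUDIT (INBOX 2026-08-22T10:54Z, `HOME/b2b-bsdres-lit-kato/gen36/KATO-PAGE-READ-gen36.md` 2175bd9283491ed4): AUD-14 PASS (Kato's (14.9.1) p. 239 Poitou–Tate for ramified T, local terms only at p; the j_*-bookkeeping at bad primes = Lemma T's ∏c_ℓ^{(p)}), AUD-17 ANSWERED (Prop. 3.2 of arXiv:1603.08640v3, PDF p. 9; VoR numbering pending acq-10137), AUD-19 PASS (descent = Kato (14.14.1)–(14.14.2) p. 243 + 13.8 p. 228 twisted; length lemma = Kato Lemma 14.15 pp.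 243–244; Cor. 14.3 p. 235 hypotheses exact); nits N-4 (multiplicative bad ℓ of the anchor also fine) / N-5 / N-6 and simplifications S-1 / S-2 / C-2 are the memo's to fold]
[cite: LimSujatha2018, Prop. 3.2 (arXiv:1603.08640v3 §3)] -/
@[conjecture] def X4UpperOfCongruentFirstLayerAnchor : Prop :=
  ∀ (W : WeierstrassCurve ℚ) [W.IsElliptic] [W.IsGloballyMinimal] (p : ℕ) [Fact p.Prime],
    p ≠ 2 →
    ¬ W.HasGoodReductionAtPrime p → ¬ W.HasMultiplicativeReductionAtPrime p →
    0 ≤ padicValRat p W.j →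
    W.HasIrreducibleModPGaloisRep p →
    (∃ (W' : WeierstrassCurve ℚ) (_ : W'.IsElliptic) (_ : W'.IsGloballyMinimal),
        ModPCongruent W' W p ∧ IsKatoFirstLayerAnchor W' p) →
    W.entireLFunction 1 ≠ 0 → Finite W.sha →
    ∃ q : ℚ, W.entireLFunction 1 / (W.realPeriodRat : ℂ) = (q : ℂ) ∧
      (padicValNat p (Nat.card (AddCommGroup.primaryComponent W.sha p)) : ℤ) +
          padicValNat p W.tamagawaProduct ≤ padicValRat p q

/-- **T-X4E-t1 = (Kμ-K) ∘ (T-μ) ∘ (A⋆⋆)** for ANY reading of the interface (kernel composition). [folklore] -/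
theorem x4UpperOfCongruentFirstLayerAnchor_of (hK : X4UpperOfFineMuZero FineMuZero)
    (hT : FineMuZeroCongruenceInvariant FineMuZero) (hA : FineMuZeroOfFirstLayerAnchor FineMuZero) :
    X4UpperOfCongruentFirstLayerAnchor := by
  intro W _ _ p _ hp hg hm hj hirr hanchor hL hfin
  obtain ⟨W', hW'e, hW'm, hcong, hg', hm', hj', himg', ht', hu', hK'⟩ := hanchor
  exact hK W p hp hg hm hj hirr (hT W' W p hcong (hA W' p hp hg' hm' hj' himg' ht' hu' hK')) hL hfin

/-- A unit anchor is a first-layer anchor as soon as the first-layer certificate is supplied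
(`W′(ℚ_p)[p] = 0 ⇒ W′(ℚ_p)[p²] = 0`, so the cardinality bound holds with `1 ≤ p`).  Bookkeeping. [folklore] -/
theorem isKatoFirstLayerAnchor_of_unit {W' : WeierstrassCurve ℚ} [W'.IsElliptic] {p : ℕ} [Fact p.Prime]
    (h : IsKatoUnitAnchor W' p)
    (hK : ∃ (K : Type) (_ : Field K) (_ : NumberField K), IsFirstCyclotomicLayer K p ∧
        (W'.baseChange K).mordellWeilRank = 0 ∧
        (W'.baseChange K).sha ⊓ AddSubgroup.torsionBy (W'.baseChange K).galH1 p = ⊥) :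
    IsKatoFirstLayerAnchor W' p := by
  obtain ⟨hg, hm, hj, himg, ht, hu⟩ := h
  refine ⟨hg, hm, hj, himg, ?_, hu, hK⟩
  -- `E(ℚ_p)[p] = ⊥ ⇒ E(ℚ_p)[p²] = ⊥`: a point killed by `p²` has `p • P ∈ E[p] = ⊥`, so `P ∈ E[p] = ⊥`.
  have hsub : torsionPoints W' ℚ_[p] ((p : ℤ) ^ 2) = ⊥ := by
    rw [eq_bot_iff]
    intro P hP
    rw [mem_torsionPoints_iff] at hP
    have h1 : (p : ℤ) • P ∈ torsionPoints W' ℚ_[p] (p : ℤ) := by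
      rw [mem_torsionPoints_iff, smul_smul, ← pow_two]; exact hP
    rw [ht] at h1
    have h2 : P ∈ torsionPoints W' ℚ_[p] (p : ℤ) := by
      rw [mem_torsionPoints_iff]; exact (AddSubgroup.mem_bot.mp h1)
    rw [ht] at h2
    exact h2
  rw [hsub]
  simp only [AddSubgroup.card_bot]
  exact Nat.one_le_iff_ne_zero.mpr (Fact.out : p.Prime).ne_zero

/-- **T-X4E-t1 in the cell's currency on O6 ∧ X4 ∧ r0** (bookkeeping over GZK and modularity): a wild pair
`(W, 3)` with no rational `3`-torsion and a congruent first-layer anchor gets the UPPER half; with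
`3 ∤ #Ш_an(W)` (true for `388800ha1`, `388800ij1`: `#Ш_an = 1`) the full `3`-part.  Nothing asserted about `hX`.
[cite: Miller2011LMS, §1 and Def. 1.1] [cite: Darmon2004, Thm. 3.22] -/
theorem X4WildRankZero.missingUpperBoundAt_of_congruentFirstLayerAnchor
    (hX : X4UpperOfCongruentFirstLayerAnchor)
    (hGZK : rank_eq_analyticRank_of_analyticRank_le_one) (hmod : hasEntireLFunction_rat)
    (W : WeierstrassCurve ℚ) [W.IsElliptic] [W.IsGloballyMinimal]
    (hO : ClassO6 W 3) (hr : W.analyticRank = 0) (ht : ¬ 3 ∣ W.torsionOrder)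
    (hanchor : ∃ (W' : WeierstrassCurve ℚ) (_ : W'.IsElliptic) (_ : W'.IsGloballyMinimal),
        ModPCongruent W' W 3 ∧ IsKatoFirstLayerAnchor W' 3) :
    MissingUpperBoundAt W 3 := by
  have hirr : W.HasIrreducibleModPGaloisRep 3 := by
    obtain ⟨W', hW'e, _, ⟨e, he⟩, _, _, _, himg, _⟩ := hanchor
    exact Mazur1978.hasIrreducibleModPGaloisRep_of_addEquiv e he
      (Kato2004.hasIrreducibleModPGaloisRep_of_imageContainsSL2 W' 3 himg)
  have hL : W.entireLFunction 1 ≠ 0 := (W.analyticRank_eq_zero_iff_holds (hmod W)).mp hr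
  obtain ⟨_, hfin⟩ := hGZK W (by rw [hr]; exact zero_le_one)
  obtain ⟨q₀, hq₀, hle⟩ :=
    hX W 3 hO.1 hO.2.1.1 hO.2.1.2 (ClassO6.padicValRat_j_nonneg hO) hirr hanchor hL hfin
  have ht0 : padicValNat 3 W.torsionOrder = 0 := padicValNat.eq_zero_of_not_dvd ht
  obtain ⟨q, hq, hle'⟩ := exists_shaAn_le_add_torsion_of_katoCurrency hGZK hmod W 3 hr hfin hq₀
    (by rw [ht0, Nat.cast_zero, mul_zero, add_zero]; exact hle)
  refine ⟨q, hq, ?_⟩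
  rw [ht0, Nat.cast_zero, add_zero] at hle'
  exact hle'

/-- … and the full `3`-part when `3 ∤ #Ш_an(W)`. Bookkeeping. [cite: Miller2011LMS, §1 and Def. 1.1] -/
theorem X4WildRankZero.missingPPartAt_of_congruentFirstLayerAnchor_of_unit
    (hX : X4UpperOfCongruentFirstLayerAnchor)
    (hGZK : rank_eq_analyticRank_of_analyticRank_le_one) (hmod : hasEntireLFunction_rat)
    (W : WeierstrassCurve ℚ) [W.IsElliptic] [W.IsGloballyMinimal]
    (hO : ClassO6 W 3) (hr : W.analyticRank = 0) (ht : ¬ 3 ∣ W.torsionOrder)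
    (hanchor : ∃ (W' : WeierstrassCurve ℚ) (_ : W'.IsElliptic) (_ : W'.IsGloballyMinimal),
        ModPCongruent W' W 3 ∧ IsKatoFirstLayerAnchor W' 3)
    {q : ℚ} (hq : shaAn W = (q : ℂ)) (hunit : padicValRat 3 q = 0) :
    MissingPPartAt W 3 := by
  have hu := X4WildRankZero.missingUpperBoundAt_of_congruentFirstLayerAnchor hX hGZK hmod W hO hr ht hanchor
  refine missingPPartAt_of_lower_of_upper W 3 ⟨q, hq, ?_⟩ hu
  rw [hunit]; exact_mod_cast Nat.zero_le _

end X4Et1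

end Summit.BirchSwinnertonDyer.Rank1Residual.O6

end
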